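import Mathlib
import HarnessLib
import Summits.NavierStokesRegularity.NavierStokesRegularity.Theorems.PoloidalWindowDoorLrcModEntireSonicSheetTrig
import Summits.NavierStokesRegularity.NavierStokesRegularity.Theorems.PoloidalWindowDoorLrcModEntireQ4SonicSheetCR
import Summits.NavierStokesRegularity.NavierStokesRegularity.Theorems.PoloidalWindowDoorLrcModEntireSheetTransportCubic

/-!
# Route `PoloidalWindowDoor`, item `LrcModEntire` (stmt-NavierStokesRegularity-20428), cell (Q4-sonic, straight, μ < 0) `stub_Q4sonicLineNeg`, case I —
# THE WEB-FRAME STRAIN ROW ON A PARALLEL CHARACTERISTIC SHEET: `s`-FREE OR SINGLE-FREQUENCY PERIODIC (class-free core of S3, T2B-g17 §5(5c) / §7 S3 / §8)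

Cell ns-regularity-ideate, stub-worker seat ns-poloidal-K2-p2 g17 under the LEAD of item 20428 (ns-poloidal-K2-p3 g17, PICK 2026-08-29T20:07:35Z);
`--supports stmt-NavierStokesRegularity-20428 --as helper`.  The u-level core over `…SonicSheetTrig` (abstract Layers 1–3), `…Q4SonicSheetCR` (LEAD, B-CR) and
`…SheetTransportCubic` (LEAD, B-C3); the class-level package wrapper (hypotheses = port-2's `sonic_sheet_data_of_package` / `crossVelocity_of_package` currency)
follows in a separate file.

* `eq_of_hasDerivAt_zero`, `hasDerivAt_of_contDiffOn` — bookkeeping;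
* ★★ `sheet_trig_dichotomy` — data: a smooth bounded field `u` on `ℝ³` (the slice `U(−1+τ,·)`), `θ = u₂`, a horizontal unit vector `e` (`ν = Je`), an open
  preconnected height window `I ∋ z₀`, a web function `d ∈ C^∞(I)` with `d′ ≠ 0`, the parallel straight webs `W(s,z) = s·e + d(z)·Je + z·e₂`; hypotheses at the
  sheet = the outputs of S2/S3(b) at a sonic time with parallel webs: slice law with slope `μ₁` + characteristic relation `d′² + μ₁ = 0`, `ν`-criticality and
  `s`-homogeneous `D²θ[ν,ν]` (ridge law), `∂_z u_h = 0`, poloidal symmetry and constant horizontal trace `c` of `Du` at web points, the CROSS-WEB VELOCITY STRUCTURE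
  `u·ν∘W = g(z) + E(z)·a₃(s,z)` (`a₃ = ∂_ν(D²θ[ν,ν])∘W`, `E ∈ C²(I)` non-vanishing — `crossVelocity_of_package` with the web speed `s`-free; no bound on
  `D³u` is needed: `A` is bounded because `u` is).  CONCLUSION: EITHER `⟪Du(W)e, e⟫ = ⟪Du(W)e, ν⟫ = 0` at every web point (the strain row `(S_ee, S_eν)` vanishes: `s`-FREE sheet
  data — the Cauchy data `P = Q = 0` of the mixed system, T2B-g17 §8(8a)) OR for ONE `ω > 0` both sheet functions `u·e∘W`, `u·ν∘W` are degree-one trigonometric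
  polynomials in `ωs` with `z`-dependent coefficients, the cross-web one non-trivial at every height (PERIODIC sheet data with period `2π/ω`, §8(8b)).
  KEY STEP (separation WITHOUT square roots): the cubic transport law `∂_z(d′·(a₃(s,·) − a₃(s′,·))²) = 0` for the pairs `(s,s′), (s,0), (s′,0)` POLARISES to
  «`d′(z)·D(s,z)·D(s′,z)` is `z`-free», `D = a₃(s,·) − a₃(0,·)`; if `D(s₁,z₀) ≠ 0` then `D(s,z) = A(s)·ℓ(z)` with `A(s) = D(s,z₀)/D(s₁,z₀)` and `ℓ = D(s₁,·)` smooth and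
  non-vanishing, so `u·ν∘W = F₂(0,·) + (E·ℓ)(z)·A(s)`; if `D(·,z₀) ≡ 0` then `A ≡ 0`.  Then `…SonicSheetTrig.sheet_trig_of_separated`.

WHAT THIS IS NOT: not a claim about Navier–Stokes regularity and not a stub of the registry; class-free core for the residual research cell `stub_Q4sonicLineNeg` of
`Cruxes/LrcModEntire/Lines/twist_split.lean` v13 (bears_on LADDER-NS N0 via item 20428; items 20428 / 19708 / 27893 OPEN).
-/

noncomputable section

set_option linter.dupNamespace false
set_option linter.style.longLine false

namespace Summit.NavierStokesRegularity.NavierStokesRegularity.Theorems.PoloidalWindowDoorLrcModEntireSonicSheetStrain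

open Set Function Filter Topology
open scoped RealInnerProductSpace InnerProductSpace ContDiff
open Summit.NavierStokesRegularity.NavierStokesRegularity.Theorems.PoloidalWindowDoorLrcModEntireParallelWebsIdentity
open Summit.NavierStokesRegularity.NavierStokesRegularity.Theorems.PoloidalWindowDoorLrcModEntireQ4SonicSheetCR
open Summit.NavierStokesRegularity.NavierStokesRegularity.Theorems.PoloidalWindowDoorLrcModEntireSonicSheetTrig

/-! ### The sheet functions of a vector field on a parallel characteristic sheet (class-free core) -/

section Core

open Summit.NavierStokesRegularity.NavierStokesRegularity.Theorems.PoloidalWindowDoorLrcModEntireSheetFlattenTools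
open Summit.NavierStokesRegularity.NavierStokesRegularity.Theorems.PoloidalWindowDoorLrcModEntireSheetTransportCubic

variable {u : EuclideanSpace ℝ (Fin 3) → EuclideanSpace ℝ (Fin 3)} {e : EuclideanSpace ℝ (Fin 3)} {d μ₁ E g : ℝ → ℝ} {I : Set ℝ}
  {c Bu : ℝ} {z₀ : ℝ}

/-- A function with zero derivative at every point of an open preconnected set is constant there. -/
theorem eq_of_hasDerivAt_zero {I : Set ℝ} (hI : IsOpen I) (hIc : IsPreconnected I) {φ : ℝ → ℝ}
    (h : ∀ z ∈ I, HasDerivAt φ 0 z) {x y : ℝ} (hx : x ∈ I) (hy : y ∈ I) : φ x = φ y :=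
  hI.is_const_of_deriv_eq_zero hIc (fun z hz => (h z hz).differentiableAt.differentiableWithinAt)
    (fun z hz => (h z hz).deriv) hx hy

/-- A `C^n` function on an open set has a derivative at every point of the set (`n ≠ 0`). -/
theorem hasDerivAt_of_contDiffOn {I : Set ℝ} (hI : IsOpen I) {φ : ℝ → ℝ} {n : WithTop ℕ∞} (hφ : ContDiffOn ℝ n φ I) (hn : n ≠ 0)
    {z : ℝ} (hz : z ∈ I) : HasDerivAt φ (deriv φ z) z :=
  ((hφ.contDiffAt (hI.mem_nhds hz)).differentiableAt hn).hasDerivAt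

/-- ★★ **THE TRIGONOMETRIC LAW ON A PARALLEL CHARACTERISTIC SHEET (class-free core of T2B-g17 §5(5c) / §7 S3).**  Data: a smooth bounded vector field `u` on
`ℝ³` (the slice `U(−1+τ,·)`) with vertical component `θ = u₂`; a horizontal unit vector `e`, `ν = Je`; an open preconnected height window `I ∋ z₀`; a web
function `d ∈ C^∞(I)` with `d′ ≠ 0`; the parallel straight webs `W(s,z) = s·e + d(z)·Je + z·e₂`.  Hypotheses at the sheet: the slice law for `θ` with slope `μ₁`
on the slab `{x₂ ∈ I}` and the characteristic relation `d′² + μ₁ = 0` (S2 (ii)); `ν`-criticality of `θ` and `s`-homogeneity of `D²θ[ν,ν]` along every web (ridge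
law, S2 (vi)); vanishing vertical derivative of `u_h`, horizontal symmetry (poloidal) and constant horizontal trace `c` of `Du` at the web points (S2 (viii)(iii));
the CROSS-WEB VELOCITY STRUCTURE `u·ν∘W = g(z) + E(z)·a₃(s,z)`, `a₃ = ∂_ν(D²θ[ν,ν])∘W`, `E ∈ C²(I)` non-vanishing (S3(b) `crossVelocity_of_package` with `V` s-free).
Conclusion: EITHER the web-frame strain row vanishes on the sheet — `⟪Du(W)e, e⟫ = ⟪Du(W)e, ν⟫ = 0` at every web point
(`s`-FREE sheet data) — OR for some `ω > 0` both sheet functions `u·e∘W`, `u·ν∘W` are degree-one trigonometric polynomials in `ωs` with `z`-dependent coefficients,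
the cross-web one non-trivially at every height (PERIODIC sheet data, period `2π/ω`).  Proof: polarised cubic transport (`cubic_transport_conserved`) ⇒ separated
form without square roots; sheet Cauchy–Riemann (`sheet_CR_fst/snd`); Layer 3. -/
theorem sheet_trig_dichotomy (hu : ContDiff ℝ ∞ u) (hubdd : ∀ y, ‖u y‖ ≤ Bu)
    (hI : IsOpen I) (hIc : IsPreconnected I) (hz₀ : z₀ ∈ I)
    (hd : ContDiffOn ℝ ∞ d I) (hd0 : ∀ z ∈ I, deriv d z ≠ 0) (hμ₁ : ∀ z ∈ I, DifferentiableAt ℝ μ₁ z)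
    (he2 : e 2 = 0) (hunit : e 0 ^ 2 + e 1 ^ 2 = 1)
    (hlaw : ∀ x : EuclideanSpace ℝ (Fin 3), x 2 ∈ I →
      fderiv ℝ (fun y => fderiv ℝ (fun y => u y 2) y (EuclideanSpace.single 2 (1 : ℝ))) x (EuclideanSpace.single 2 (1 : ℝ)) =
        -μ₁ (x 2) * (fderiv ℝ (fun y => fderiv ℝ (fun y => u y 2) y (EuclideanSpace.single 0 (1 : ℝ))) x (EuclideanSpace.single 0 (1 : ℝ)) +
          fderiv ℝ (fun y => fderiv ℝ (fun y => u y 2) y (EuclideanSpace.single 1 (1 : ℝ))) x (EuclideanSpace.single 1 (1 : ℝ))))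
    (hQ0 : ∀ z ∈ I, deriv d z ^ 2 + μ₁ z = 0)
    (hweb : ∀ s : ℝ, ∀ z ∈ I, fderiv ℝ (fun y => u y 2) (s • e + d z • Jvec e + z • e2) (Jvec e) = 0)
    (hhom : ∀ s s' : ℝ, ∀ z ∈ I,
      fderiv ℝ (fderiv ℝ (fun y => u y 2)) (s • e + d z • Jvec e + z • e2) (Jvec e) (Jvec e) =
        fderiv ℝ (fderiv ℝ (fun y => u y 2)) (s' • e + d z • Jvec e + z • e2) (Jvec e) (Jvec e))
    (hvz : ∀ s : ℝ, ∀ z ∈ I, ⟪fderiv ℝ u (s • e + d z • Jvec e + z • e2) e2, e⟫ = 0 ∧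
      ⟪fderiv ℝ u (s • e + d z • Jvec e + z • e2) e2, Jvec e⟫ = 0)
    (hpol : ∀ s : ℝ, ∀ z ∈ I, ⟪fderiv ℝ u (s • e + d z • Jvec e + z • e2) e, Jvec e⟫ =
      ⟪fderiv ℝ u (s • e + d z • Jvec e + z • e2) (Jvec e), e⟫)
    (htr : ∀ s : ℝ, ∀ z ∈ I, ⟪fderiv ℝ u (s • e + d z • Jvec e + z • e2) e, e⟫ +
      ⟪fderiv ℝ u (s • e + d z • Jvec e + z • e2) (Jvec e), Jvec e⟫ = c)
    (hE : ContDiffOn ℝ 2 E I) (hE0 : ∀ z ∈ I, E z ≠ 0)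
    (hcross : ∀ s : ℝ, ∀ z ∈ I, ⟪u (s • e + d z • Jvec e + z • e2), Jvec e⟫ =
      g z + E z * fderiv ℝ (fun x => fderiv ℝ (fderiv ℝ (fun y => u y 2)) x (Jvec e) (Jvec e)) (s • e + d z • Jvec e + z • e2) (Jvec e)) :
    (∀ s : ℝ, ∀ z ∈ I, ⟪fderiv ℝ u (s • e + d z • Jvec e + z • e2) e, e⟫ = 0 ∧ ⟪fderiv ℝ u (s • e + d z • Jvec e + z • e2) e, Jvec e⟫ = 0) ∨
    (∃ w : ℝ, 0 < w ∧ ∃ a₀ a₁ b₁ a₀' a₁' b₁' : ℝ → ℝ, (∀ z ∈ I, a₁' z ≠ 0 ∨ b₁' z ≠ 0) ∧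
      ∀ s : ℝ, ∀ z ∈ I, ⟪u (s • e + d z • Jvec e + z • e2), e⟫ = a₀ z + a₁ z * Real.cos (w * s) + b₁ z * Real.sin (w * s) ∧
        ⟪u (s • e + d z • Jvec e + z • e2), Jvec e⟫ = a₀' z + a₁' z * Real.cos (w * s) + b₁' z * Real.sin (w * s)) := by
  -- notation
  set θ : EuclideanSpace ℝ (Fin 3) → ℝ := fun y => u y 2 with hθ_def
  have hθ : ContDiff ℝ ∞ θ := by
    have : θ = (fun v : EuclideanSpace ℝ (Fin 3) => v 2) ∘ u := rfl
    rw [this]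
    exact ((EuclideanSpace.proj (𝕜 := ℝ) (2 : Fin 3)).contDiff).comp hu
  set K : EuclideanSpace ℝ (Fin 3) → ℝ := fun x => fderiv ℝ (fun x => fderiv ℝ (fderiv ℝ θ) x (Jvec e) (Jvec e)) x (Jvec e) with hK_def
  have hK : ContDiff ℝ ∞ K := by
    have h2 : ContDiff ℝ ∞ (fun x => fderiv ℝ (fderiv ℝ θ) x (Jvec e) (Jvec e)) :=
      (((hθ.fderiv_right (m := ∞) (by norm_cast)).fderiv_right (m := ∞) (by norm_cast)).clm_apply contDiff_const).clm_apply contDiff_const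
    exact (h2.fderiv_right (m := ∞) (by norm_cast)).clm_apply contDiff_const
  set Wd : ℝ × ℝ → EuclideanSpace ℝ (Fin 3) := webMap e (fun q : ℝ × ℝ => d q.2) with hWd_def
  have hW : ∀ s z : ℝ, Wd (s, z) = s • e + d z • Jvec e + z • e2 := fun s z => rfl
  set a₃ : ℝ → ℝ → ℝ := fun s z => K (s • e + d z • Jvec e + z • e2) with ha₃_def
  set F₁ : ℝ × ℝ → ℝ := fun q => ⟪u (Wd q), e⟫ with hF₁_def
  set F₂ : ℝ × ℝ → ℝ := fun q => ⟪u (Wd q), Jvec e⟫ with hF₂_def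
  -- regularity of the web map and the sheet functions on the region
  have hud : Differentiable ℝ u := hu.differentiable (by simp)
  have hdreg : ContDiffOn ℝ ∞ (fun q : ℝ × ℝ => d q.2) (region I) := by
    intro q hq
    exact ((hd.contDiffAt (hI.mem_nhds hq)).comp_contDiffWithinAt q contDiff_snd.contDiffWithinAt).mono (fun _ _ => trivial) |>.mono_of_mem_nhdsWithin
      (by exact self_mem_nhdsWithin)
  have hWreg : ContDiffOn ℝ ∞ Wd (region I) := by
    have h1 : ContDiffOn ℝ ∞ (fun q : ℝ × ℝ => q.1 • e) (region I) := (contDiff_fst.smul contDiff_const).contDiffOn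
    have h2 : ContDiffOn ℝ ∞ (fun q : ℝ × ℝ => d q.2 • Jvec e) (region I) := hdreg.smul contDiffOn_const
    have h3 : ContDiffOn ℝ ∞ (fun q : ℝ × ℝ => q.2 • e2) (region I) := (contDiff_snd.smul contDiff_const).contDiffOn
    exact (h1.add h2).add h3
  have hF₁reg : ContDiffOn ℝ 2 F₁ (region I) :=
    ((hu.comp_contDiffOn hWreg).inner ℝ contDiffOn_const).of_le (by norm_cast)
  have hF₂reg : ContDiffOn ℝ 1 F₂ (region I) :=
    ((hu.comp_contDiffOn hWreg).inner ℝ contDiffOn_const).of_le (by norm_cast)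
  have hdd : ∀ z ∈ I, DifferentiableAt ℝ d z := fun z hz => (hd.contDiffAt (hI.mem_nhds hz)).differentiableAt (by simp)
  -- the Cauchy–Riemann pair on the sheet
  have hCR1 : ∀ s : ℝ, ∀ z ∈ I, fderiv ℝ F₁ (s, z) ((0 : ℝ), (1 : ℝ)) = deriv d z * fderiv ℝ F₂ (s, z) ((1 : ℝ), (0 : ℝ)) := by
    intro s z hz
    exact sheet_CR_fst (e := e) (d := d) (p := (s, z)) (hdd z hz) (hud _) (hvz s z hz).1 (hpol s z hz)
  have hCR2 : ∀ s : ℝ, ∀ z ∈ I, fderiv ℝ F₂ (s, z) ((0 : ℝ), (1 : ℝ)) = deriv d z * (c - fderiv ℝ F₁ (s, z) ((1 : ℝ), (0 : ℝ))) := by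
    intro s z hz
    exact sheet_CR_snd (e := e) (d := d) (p := (s, z)) (hdd z hz) (hud _) (hvz s z hz).2 (htr s z hz)
  -- the along-web derivatives are the strain row
  have hsF₁ : ∀ s : ℝ, ∀ z ∈ I, fderiv ℝ F₁ (s, z) ((1 : ℝ), (0 : ℝ)) = ⟪fderiv ℝ u (s • e + d z • Jvec e + z • e2) e, e⟫ := by
    intro s z hz
    have h := fderiv_sheetComponent (e := e) (d := d) (p := (s, z)) (hdd z hz) (hud _) e ((1 : ℝ), (0 : ℝ))
    simp only [mul_zero, zero_mul, add_zero, one_mul] at h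
    exact h
  have hsF₂ : ∀ s : ℝ, ∀ z ∈ I, fderiv ℝ F₂ (s, z) ((1 : ℝ), (0 : ℝ)) = ⟪fderiv ℝ u (s • e + d z • Jvec e + z • e2) e, Jvec e⟫ := by
    intro s z hz
    have h := fderiv_sheetComponent (e := e) (d := d) (p := (s, z)) (hdd z hz) (hud _) (Jvec e) ((1 : ℝ), (0 : ℝ))
    simp only [mul_zero, zero_mul, add_zero, one_mul] at h
    exact h
  -- boundedness of `F₁`
  have hF₁bdd : ∀ z ∈ I, ∀ s : ℝ, |F₁ (s, z)| ≤ Bu * ‖e‖ := by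
    intro z _ s
    calc |F₁ (s, z)| = |⟪u (Wd (s, z)), e⟫| := rfl
      _ ≤ ‖u (Wd (s, z))‖ * ‖e‖ := abs_real_inner_le_norm _ _
      _ ≤ Bu * ‖e‖ := mul_le_mul_of_nonneg_right (hubdd _) (norm_nonneg _)
  have hF₂bdd : ∀ s : ℝ, |F₂ (s, z₀)| ≤ Bu * ‖Jvec e‖ := by
    intro s
    calc |F₂ (s, z₀)| = |⟪u (Wd (s, z₀)), Jvec e⟫| := rfl
      _ ≤ ‖u (Wd (s, z₀))‖ * ‖Jvec e‖ := abs_real_inner_le_norm _ _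
      _ ≤ Bu * ‖Jvec e‖ := mul_le_mul_of_nonneg_right (hubdd _) (norm_nonneg _)
  -- THE POLARISED CUBIC TRANSPORT: `d′(z)·(a₃(s,z) − a₃(s′,z))²` is `z`-free for all `s, s′`
  have hC : ∀ s s' : ℝ, ∀ z ∈ I, deriv d z * (a₃ s z - a₃ s' z) ^ 2 = deriv d z₀ * (a₃ s z₀ - a₃ s' z₀) ^ 2 := by
    intro s s' z hz
    have hder : ∀ z' ∈ I, HasDerivAt (fun z' : ℝ => deriv d z' * (a₃ s z' - a₃ s' z') ^ 2) 0 z' := fun z' hz' =>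
      cubic_transport_conserved (θ := θ) hθ hI hμ₁ hd he2 hunit hlaw hweb hhom hQ0 s s' hz'
    exact eq_of_hasDerivAt_zero hI hIc hder hz hz₀
  set D : ℝ → ℝ → ℝ := fun s z => a₃ s z - a₃ 0 z with hD_def
  have hpol2 : ∀ s s' : ℝ, ∀ z ∈ I, deriv d z * D s z * D s' z = deriv d z₀ * D s z₀ * D s' z₀ := by
    intro s s' z hz
    have h1 := hC s 0 z hz
    have h2 := hC s' 0 z hz
    have h3 := hC s s' z hz
    simp only [hD_def]
    nlinarith [h1, h2, h3]
  -- smoothness of `a₃` along webs and across heights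
  have ha₃s : ∀ z : ℝ, ContDiff ℝ ∞ (fun s : ℝ => a₃ s z) := by
    intro z
    have hline : ContDiff ℝ ∞ (fun s : ℝ => s • e + d z • Jvec e + z • e2) :=
      ((contDiff_id.smul contDiff_const).add contDiff_const).add contDiff_const
    exact hK.comp hline
  have ha₃z : ∀ s : ℝ, ContDiffOn ℝ ∞ (fun z : ℝ => a₃ s z) I := by
    intro s
    have hline : ContDiffOn ℝ ∞ (fun z : ℝ => s • e + d z • Jvec e + z • e2) I :=
      ((contDiffOn_const).add (hd.smul contDiffOn_const)).add (contDiff_id.smul contDiff_const).contDiffOn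
    exact hK.comp_contDiffOn hline
  -- `G = F₂(0,·)` and its regularity
  have hGreg : ContDiffOn ℝ ∞ (fun z : ℝ => F₂ (0, z)) I := by
    have hline : ContDiffOn ℝ ∞ (fun z : ℝ => (0 : ℝ) • e + d z • Jvec e + z • e2) I :=
      ((contDiffOn_const).add (hd.smul contDiffOn_const)).add (contDiff_id.smul contDiff_const).contDiffOn
    exact (hu.comp_contDiffOn hline).inner ℝ contDiffOn_const
  have hd1 : ContDiffOn ℝ ∞ (deriv d) I := hd.deriv_of_isOpen hI (m := ∞) (by simp)
  -- THE SEPARATED FORM `F₂(s,z) = G(z) + Et(z)·A(s)` with `A` bounded, smooth, and `Et ∈ C²(I)` non-vanishing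
  obtain ⟨A, Et, hAs, hEt2, hEt0, hsep⟩ : ∃ A Et : ℝ → ℝ, ContDiff ℝ ∞ A ∧ ContDiffOn ℝ 2 Et I ∧
      (∀ z ∈ I, Et z ≠ 0) ∧ ∀ s : ℝ, ∀ z ∈ I, F₂ (s, z) = F₂ (0, z) + Et z * A s := by
    by_cases hdeg : ∀ s : ℝ, a₃ s z₀ = a₃ 0 z₀
    · -- degenerate: `a₃` is `s`-free on the whole sheet
      refine ⟨fun _ => 0, E, contDiff_const, hE, hE0, fun s z hz => ?_⟩
      have h1 := hC s 0 z hz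
      rw [hdeg s, sub_self, zero_pow two_ne_zero, mul_zero] at h1
      have hDz : a₃ s z = a₃ 0 z := by
        rcases mul_eq_zero.1 h1 with h | h
        · exact absurd h (hd0 z hz)
        · exact sub_eq_zero.1 (pow_eq_zero_iff two_ne_zero |>.1 h)
      simp only [hF₂_def, hW, mul_zero, add_zero]
      rw [hcross s z hz, hcross 0 z hz]
      show g z + E z * a₃ s z = g z + E z * a₃ 0 z
      rw [hDz]
    · push Not at hdeg
      obtain ⟨s₁, hs₁⟩ := hdeg
      have hD₁ : D s₁ z₀ ≠ 0 := sub_ne_zero.2 hs₁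
      refine ⟨fun s => D s z₀ / D s₁ z₀, fun z => E z * D s₁ z, ?_, ?_, ?_, fun s z hz => ?_⟩
      · exact ((ha₃s z₀).sub contDiff_const).div_const _
      · exact hE.mul (((ha₃z s₁).sub (ha₃z 0)).of_le (by norm_cast))
      · intro z hz hzero
        have h := hC s₁ 0 z hz
        have hDz : D s₁ z = 0 := by
          rcases mul_eq_zero.1 hzero with h' | h'
          · exact absurd h' (hE0 z hz)
          · exact h'
        simp only [hD_def] at hDz
        rw [hDz, zero_pow two_ne_zero, mul_zero] at h
        have : deriv d z₀ * (a₃ s₁ z₀ - a₃ 0 z₀) ^ 2 ≠ 0 := mul_ne_zero (hd0 z₀ hz₀) (pow_ne_zero 2 (sub_ne_zero.2 hs₁))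
        exact this h.symm
      · -- `F₂(s,z) − F₂(0,z) = E z·D(s,z)` and `D(s,z)·(d′(z)D(s₁,z)) = d′(z₀)D(s,z₀)D(s₁,z₀) = (D(s,z₀)/D(s₁,z₀))·D(s₁,z)·(d′(z)D(s₁,z))`
        have hkey : D s z = D s z₀ / D s₁ z₀ * D s₁ z := by
          have h1 := hpol2 s s₁ z hz
          have h2 := hpol2 s₁ s₁ z hz
          have hne : deriv d z * D s₁ z ≠ 0 := by
            intro hzero
            have h2' : deriv d z₀ * D s₁ z₀ * D s₁ z₀ = 0 := by rw [← h2, hzero, zero_mul]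
            exact mul_ne_zero (mul_ne_zero (hd0 z₀ hz₀) hD₁) hD₁ h2'
          have h3 : (D s z * D s₁ z₀) * (deriv d z * D s₁ z) = (D s z₀ * D s₁ z) * (deriv d z * D s₁ z) := by
            calc (D s z * D s₁ z₀) * (deriv d z * D s₁ z) = (deriv d z * D s z * D s₁ z) * D s₁ z₀ := by ring
              _ = (deriv d z₀ * D s z₀ * D s₁ z₀) * D s₁ z₀ := by rw [h1]
              _ = D s z₀ * (deriv d z₀ * D s₁ z₀ * D s₁ z₀) := by ring
              _ = D s z₀ * (deriv d z * D s₁ z * D s₁ z) := by rw [h2]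
              _ = (D s z₀ * D s₁ z) * (deriv d z * D s₁ z) := by ring
          have h4 : D s z * D s₁ z₀ = D s z₀ * D s₁ z := mul_right_cancel₀ hne h3
          field_simp
          linarith [h4]
        simp only [hF₂_def, hW]
        rw [hcross s z hz, hcross 0 z hz]
        change g z + E z * a₃ s z = g z + E z * a₃ 0 z + E z * D s₁ z * (D s z₀ / D s₁ z₀)
        have : a₃ s z = a₃ 0 z + D s z := by simp [hD_def]
        rw [this, hkey]
        ring
  -- derivatives of the coefficient functions
  have hAd : ∀ s, HasDerivAt A (deriv A s) s := fun s => ((hAs.differentiable (by simp)) s).hasDerivAt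
  have hA1 : ContDiff ℝ ∞ (deriv A) := hAs.deriv'
  have hA'd : ∀ s, HasDerivAt (deriv A) (deriv (deriv A) s) s := fun s => ((hA1.differentiable (by simp)) s).hasDerivAt
  have hGd : ∀ z ∈ I, HasDerivAt (fun z : ℝ => F₂ (0, z)) (deriv (fun z : ℝ => F₂ (0, z)) z) z := fun z hz =>
    hasDerivAt_of_contDiffOn hI hGreg (by simp) hz
  have hEtd : ∀ z ∈ I, HasDerivAt Et (deriv Et z) z := fun z hz => hasDerivAt_of_contDiffOn hI hEt2 (by norm_num) hz
  have hG1 : ContDiffOn ℝ ∞ (deriv fun z : ℝ => F₂ (0, z)) I := hGreg.deriv_of_isOpen hI (m := ∞) (by simp)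
  have hEt1 : ContDiffOn ℝ 1 (deriv Et) I := hEt2.deriv_of_isOpen hI (m := 1) (by norm_cast)
  have hquot : ∀ {φ : ℝ → ℝ} {n : WithTop ℕ∞}, ContDiffOn ℝ n φ I → n ≠ 0 → ∀ z ∈ I,
      HasDerivAt (fun z' => φ z' / deriv d z') (deriv (fun z' => φ z' / deriv d z') z) z := by
    intro φ n hφ hn z hz
    have h1 : DifferentiableAt ℝ φ z := (hφ.contDiffAt (hI.mem_nhds hz)).differentiableAt hn
    have h2 : DifferentiableAt ℝ (deriv d) z := (hd1.contDiffAt (hI.mem_nhds hz)).differentiableAt (by simp)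
    exact (h1.div h2 (hd0 z hz)).hasDerivAt
  have hmain := sheet_trig_of_separated hI hz₀ hF₁reg hF₂reg (A := A) (A' := deriv A) (A'' := deriv (deriv A))
    (G := fun z : ℝ => F₂ (0, z)) (G' := deriv fun z : ℝ => F₂ (0, z)) (Et := Et) (Et' := deriv Et) (dd := deriv d)
    (P := fun z => deriv (fun z' => deriv Et z' / deriv d z') z) (Q := fun z => deriv (fun z' => deriv (fun z : ℝ => F₂ (0, z)) z' / deriv d z') z)
    (B := fun _ => Bu * ‖e‖) (c := c) (M := Bu * ‖Jvec e‖)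
    hAd hA'd hsep hF₂bdd hGd hEtd hEt0 hd0 (fun z hz => hquot hEt1 (by norm_num) z hz) (fun z hz => hquot hG1 (by simp) z hz)
    hCR1 hCR2 hF₁bdd
  rcases hmain with hfree | ⟨w, hw, a₀, a₁, b₁, a₀', a₁', b₁', hnt, hform⟩
  · left
    intro s z hz
    obtain ⟨h1, h2⟩ := hfree s z hz
    exact ⟨by rw [← hsF₁ s z hz]; exact h1, by rw [← hsF₂ s z hz]; exact h2⟩
  · right
    exact ⟨w, hw, a₀, a₁, b₁, a₀', a₁', b₁', hnt, fun s z hz => hform s z hz⟩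

end Core

end Summit.NavierStokesRegularity.NavierStokesRegularity.Theorems.PoloidalWindowDoorLrcModEntireSonicSheetStrain

end
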